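import Literature.NumberTheory.LFunctions.HeilbronnStark
import Literature.NumberTheory.LFunctions.StarkExceptionalZeroProofs
import Literature.NumberTheory.LFunctions.StarkAtMostOneZeroBridge
import Literature.NumberTheory.LFunctions.ZetaRealAxis
import Literature.NumberTheory.NumberFields.GaloisClosureDiscriminant
import Literature.NumberTheory.NumberFields.ArithmeticEquivalenceProofs
import Literature.NumberTheory.LFunctions.DedekindZetaThetaProofs
import Mathlib.FieldTheory.Normal.Closure
import Mathlib.FieldTheory.Galois.Infinite
import HarnessLib

/-!
# Stark 1974, Theorem 3: no exceptional zero without a quadratic subfield — glue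

Topic `Literature/NumberTheory/LFunctions`, namespace `Literature.NumberTheory.LFunctions.NumberField`.
Everything in this file is PROVED (theorems only).

Galois-theoretic and analytic glue for the sibling proofs file
`StarkNoQuadraticSubfieldProofs.lean` (D-0014), which discharges the named fact
`Literature.NumberTheory.LFunctions.NumberField.Stark1974_dedekindZeta_ne_zero_of_noQuadraticSubfield`
following [MurtyMurty1997, Ch. 2 §6, Cor. 6.2] = [Stark1974, Lemma 3, Thm. 3]:

* G1 iso-invariance of the continued Dedekind zeta function (`dedekindZetaCont_eq_of_algEquiv`);
* G2–G4 the normal closure `N` of `K/F` inside a normal `L`: `⨆_f f(K) = ⊤`, `Aut_F(N)` acts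
  faithfully on the embeddings `K → N`, so `#Aut_F(N) ≤ [K:F]!`;
* G5 `|d_N| ≤ |d_K|^{[N:ℚ]}` when the embedded copies of `K` separate `Gal(N/ℚ)`
  (`GaloisClosureDiscriminant`), G6 `|d_K| = 1` in degree one, G7 transport of a quadratic
  subfield along an embedding;
* G8 the restriction `Γ_F → Gal(N₀/F)` to a finite normal `N₀ ⊆ F̄` is an `IsArtinQuotient`, and
  the fixed fields it cuts out (`F̄^{Γ_E} = E`, `F̄^{ker} = N₀`, `F̄^{Γ_F} = F`);
* G9 Stark's Lemma 3 (`Stark1974_atMostOneZero_holds`) as the order bound `ord_s ζ_N ≤ 1` in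
  Stark's box, and the elementary inequalities placing `[1 − 1/(4 n! log|d_K|), 1)` in the box of
  the Galois closure.

## References

* H. M. Stark, *Some effective cases of the Brauer–Siegel theorem*, Invent. Math. 23 (1974)
  135–152, Lemma 3, Theorem 3. [Stark1974]
* M. R. Murty, V. K. Murty, *Non-vanishing of `L`-functions and applications*, Birkhäuser 1997,
  Ch. 2 §5–§6, Prop. 6.1, Cor. 6.2 (read, pp. 31–33). [MurtyMurty1997]
-/

noncomputable section

open scoped NumberField ComplexConjugate ComplexOrder
open Complex NumberField IntermediateField
open Literature.NumberTheory.Automorphic Literature.NumberTheory.LFunctions.Heilbronn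

namespace Literature.NumberTheory.LFunctions.NumberField

/-! ### G1: iso-invariance of the continued Dedekind zeta function -/

/-- Isomorphic number fields have the same continued Dedekind zeta function off `s = 1`. [folklore] -/
theorem dedekindZetaCont_eq_of_algEquiv {K K' : Type*} [Field K] [NumberField K] [Field K']
    [NumberField K'] (e : K ≃ₐ[ℚ] K') {s : ℂ} (hs : s ≠ 1) :
    dedekindZetaCont K s = dedekindZetaCont K' s := by
  have hzeta : _root_.NumberField.dedekindZeta K = _root_.NumberField.dedekindZeta K' :=
    (Literature.NumberTheory.NumberFields.ArithmeticallyEquivalent.of_algEquiv e).dedekindZeta_eq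
  have h1 : IsDedekindZetaContinuation K (dedekindZetaCont K) :=
    isDedekindZetaContinuation_dedekindZetaCont_holds K
  have h2 : IsDedekindZetaContinuation K (dedekindZetaCont K') := by
    have h := isDedekindZetaContinuation_dedekindZetaCont_holds K'
    exact ⟨h.differentiableOn, by rw [hzeta]; exact h.eqOn⟩
  exact IsDedekindZetaContinuation.unique h1 h2 hs

/-! ### G2–G4: the normal closure is generated by the embedded copies; the Galois group permutes them faithfully -/

section NormalClosure

variable (F K L : Type*) [Field F] [Field K] [Field L] [Algebra F K] [Algebra F L]

/-- The normal closure `N` of `K/F` inside a normal `L/F` is generated by the images of the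
`F`-embeddings `K → N`: `⨆_f f(K) = ⊤` in `N`. [folklore] -/
theorem iSup_fieldRange_normalClosure_eq_top :
    ⨆ f : K →ₐ[F] normalClosure F K L, f.fieldRange = ⊤ := by
  apply IntermediateField.map_injective (normalClosure F K L).val
  rw [IntermediateField.map_iSup, ← AlgHom.fieldRange_eq_map, IntermediateField.fieldRange_val]
  conv_rhs => rw [normalClosure_def]
  simp_rw [AlgHom.map_fieldRange]
  exact Equiv.iSup_congr (normalClosure.algHomEquiv F K L) fun f => rfl

/-- **The automorphisms of the normal closure act faithfully on the embedded copies of `K`**: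
an automorphism fixing every `f(K)` pointwise is the identity. [folklore] -/
theorem algEquiv_eq_one_of_forall_mem_fixingSubgroup
    (s : normalClosure F K L ≃ₐ[F] normalClosure F K L)
    (hs : ∀ f : K →ₐ[F] normalClosure F K L, s ∈ f.fieldRange.fixingSubgroup) : s = 1 := by
  have hle : ∀ f : K →ₐ[F] normalClosure F K L,
      f.fieldRange ≤ IntermediateField.fixedField (Subgroup.zpowers s) := fun f => by
    rw [IntermediateField.le_iff_le, Subgroup.zpowers_le]
    exact hs f
  have htop : (⊤ : IntermediateField F (normalClosure F K L)) ≤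
      IntermediateField.fixedField (Subgroup.zpowers s) := by
    rw [← iSup_fieldRange_normalClosure_eq_top F K L]
    exact iSup_le hle
  have hmem : s ∈ (⊤ : IntermediateField F (normalClosure F K L)).fixingSubgroup := by
    have h := (IntermediateField.le_iff_le _ _).mp htop
    exact h (Subgroup.mem_zpowers s)
  rwa [IntermediateField.fixingSubgroup_top, Subgroup.mem_bot] at hmem

/-- Separating family form: every `s ≠ 1` moves some embedded copy of `K`. [folklore] -/
theorem exists_not_mem_fixingSubgroup_fieldRange
    {s : normalClosure F K L ≃ₐ[F] normalClosure F K L} (hs : s ≠ 1) :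
    ∃ f : K →ₐ[F] normalClosure F K L, s ∉ f.fieldRange.fixingSubgroup := by
  by_contra h
  push Not at h
  exact hs (algEquiv_eq_one_of_forall_mem_fixingSubgroup F K L s h)

/-- The automorphism group of the normal closure acts faithfully on the embeddings `K → N`
by composition: `Aut_F(N) ↪ Perm(K →ₐ[F] N)`. [folklore] -/
theorem exists_injective_algEquiv_normalClosure_toPerm :
    ∃ ι : (normalClosure F K L ≃ₐ[F] normalClosure F K L) →
      Equiv.Perm (K →ₐ[F] normalClosure F K L), Function.Injective ι := by
  refine ⟨fun s => ⟨fun f => s.toAlgHom.comp f, fun f => s.symm.toAlgHom.comp f,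
      fun f => by ext x; simp, fun f => by ext x; simp⟩, fun s s' h => ?_⟩
  have key : ∀ f : K →ₐ[F] normalClosure F K L, s.toAlgHom.comp f = s'.toAlgHom.comp f :=
    fun f => congrFun (congrArg Equiv.toFun h) f
  have h1 : s'⁻¹ * s = 1 := by
    refine algEquiv_eq_one_of_forall_mem_fixingSubgroup F K L _ fun f => ?_
    rw [IntermediateField.mem_fixingSubgroup_iff]
    rintro _ ⟨x, rfl⟩
    have hx := congrArg (fun g : K →ₐ[F] normalClosure F K L => g x) (key f)
    have hx' : s (f x) = s' (f x) := hx
    show s'.symm (s (f x)) = f x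
    rw [hx', AlgEquiv.symm_apply_apply]
  exact (inv_mul_eq_one.mp h1).symm

/-- **`#Aut_F(N) ≤ [K : F]!`** for the normal closure `N` of a finite extension `K/F` inside a
normal `L/F` (faithful action on the `≤ [K:F]` embeddings `K → N`). [folklore] -/
theorem card_algEquiv_normalClosure_le_factorial [FiniteDimensional F K] :
    Fintype.card (normalClosure F K L ≃ₐ[F] normalClosure F K L) ≤
      (Module.finrank F K).factorial := by
  classical
  obtain ⟨ι, hι⟩ := exists_injective_algEquiv_normalClosure_toPerm F K L
  calc Fintype.card (normalClosure F K L ≃ₐ[F] normalClosure F K L)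
      ≤ Fintype.card (Equiv.Perm (K →ₐ[F] normalClosure F K L)) :=
        Fintype.card_le_of_injective ι hι
    _ = (Fintype.card (K →ₐ[F] normalClosure F K L)).factorial := Fintype.card_perm
    _ ≤ (Module.finrank F K).factorial := by
        refine Nat.factorial_le ?_
        rw [← Nat.card_eq_fintype_card]
        exact card_algHom_le_finrank F K (normalClosure F K L)
end NormalClosure

/-! ### G5: the discriminant and the degree of a normal closure (abstract form) -/

section Discr

variable (K : Type*) [Field K] [NumberField K] (N : Type*) [Field N] [NumberField N]

/-- An embedded copy `f(K)` of `K` has the discriminant of `K`. [folklore] -/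
theorem natAbs_discr_fieldRange (f : K →ₐ[ℚ] N) :
    (discr f.fieldRange).natAbs = (discr K).natAbs :=
  congrArg Int.natAbs (NumberField.discr_eq_discr_of_algEquiv _
    ((IntermediateField.topEquiv.symm.trans ((⊤ : IntermediateField ℚ K).equivMap f)).trans
      (IntermediateField.equivOfEq (AlgHom.fieldRange_eq_map f).symm))).symm

/-- `[K : ℚ] · [N : f(K)] = [N : ℚ]` for an embedding `f : K → N`. [folklore] -/
theorem finrank_mul_finrank_fieldRange (f : K →ₐ[ℚ] N) :
    Module.finrank ℚ K * Module.finrank f.fieldRange N = Module.finrank ℚ N := by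
  have e : K ≃ₐ[ℚ] f.fieldRange :=
    (IntermediateField.topEquiv.symm.trans ((⊤ : IntermediateField ℚ K).equivMap f)).trans
      (IntermediateField.equivOfEq (AlgHom.fieldRange_eq_map f).symm)
  have h1 : Module.finrank ℚ K = Module.finrank ℚ f.fieldRange := e.toLinearEquiv.finrank_eq
  rw [h1]
  exact Module.finrank_mul_finrank ℚ f.fieldRange N

/-- **`|d_N| ≤ |d_K|^{[N:ℚ]}` when the embedded copies of `K` separate `Gal(N/ℚ)`** (e.g. `N` a
normal closure of `K`): `|d_N| ∣ ∏_f |d_{f(K)}|^{[N:f(K)]}` (`natAbs_discr_dvd_prod_pow_of_isGalois`)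
and `Σ_f [N : f(K)] ≤ [N : ℚ]` as there are at most `[K:ℚ]` embeddings. [cite: Stark1974, §3] -/
theorem natAbs_discr_le_pow_of_separating [IsGalois ℚ N]
    (hsep : ∀ s : N ≃ₐ[ℚ] N, s ≠ 1 → ∃ f : K →ₐ[ℚ] N, s ∉ f.fieldRange.fixingSubgroup) :
    (discr N).natAbs ≤ (discr K).natAbs ^ Module.finrank ℚ N := by
  classical
  have hdvd := Literature.NumberTheory.NumberFields.natAbs_discr_dvd_prod_pow_of_isGalois N
    Finset.univ (fun f : K →ₐ[ℚ] N => f.fieldRange) (fun s hs => by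
      obtain ⟨f, hf⟩ := hsep s hs
      exact ⟨f, Finset.mem_univ _, hf⟩)
  have hdK : (discr K).natAbs ≠ 0 := Int.natAbs_ne_zero.mpr (discr_ne_zero K)
  rw [Finset.prod_congr rfl fun f _ => by rw [natAbs_discr_fieldRange K N f],
    Finset.prod_pow_eq_pow_sum] at hdvd
  refine (Nat.le_of_dvd (pow_pos (Nat.pos_of_ne_zero hdK) _) hdvd).trans
    (Nat.pow_le_pow_right (Nat.pos_of_ne_zero hdK) ?_)
  have hcard : Fintype.card (K →ₐ[ℚ] N) ≤ Module.finrank ℚ K := by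
    rw [← Nat.card_eq_fintype_card]; exact card_algHom_le_finrank ℚ K N
  have hsum : Module.finrank ℚ K * ∑ f : K →ₐ[ℚ] N, Module.finrank f.fieldRange N ≤
      Module.finrank ℚ K * Module.finrank ℚ N := by
    rw [Finset.mul_sum, Finset.sum_congr rfl fun f _ => finrank_mul_finrank_fieldRange K N f,
      Finset.sum_const, Finset.card_univ, smul_eq_mul]
    exact Nat.mul_le_mul_right _ hcard
  exact Nat.le_of_mul_le_mul_left hsum Module.finrank_pos

end Discr

/-! ### G6–G7: degree one; transport of a quadratic subfield -/

/-- A number field of degree `1` has `|d_K| = 1`. [folklore] -/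
theorem natAbs_discr_eq_one_of_finrank_eq_one {K : Type*} [Field K] [NumberField K]
    (h : Module.finrank ℚ K = 1) : (discr K).natAbs = 1 := by
  have hbot : (⊥ : IntermediateField ℚ K) = ⊤ := by
    apply IntermediateField.eq_of_le_of_finrank_eq bot_le
    rw [IntermediateField.finrank_bot, IntermediateField.finrank_top', h]
  have e : K ≃ₐ[ℚ] ℚ := (IntermediateField.topEquiv.symm.trans
    (IntermediateField.equivOfEq hbot.symm)).trans (IntermediateField.botEquiv ℚ K)
  rw [NumberField.discr_eq_discr_of_algEquiv _ e, NumberField.discr_rat]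
  rfl

/-- **Transport of a quadratic subfield along an embedding**: if `E ≤ φ(K)` has `[E : ℚ] = 2`
then `K` has a subfield of degree `2` over `ℚ` (namely `φ⁻¹(E)`). [folklore] -/
theorem exists_intermediateField_finrank_eq_two {F K M : Type*} [Field F] [Field K] [Field M]
    [Algebra F K] [Algebra F M] (φ : K →ₐ[F] M) {E : IntermediateField F M}
    (hE : E ≤ φ.fieldRange) (h2 : Module.finrank F E = 2) :
    ∃ F' : IntermediateField F K, Module.finrank F F' = 2 := by
  refine ⟨E.comap φ, ?_⟩
  have hmap : (E.comap φ).map φ = E := by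
    apply le_antisymm ((IntermediateField.gc_map_comap φ).l_u_le E)
    intro x hx
    obtain ⟨y, rfl⟩ := hE hx
    exact ⟨y, hx, rfl⟩
  have h := (((E.comap φ).equivMap φ).trans
    (IntermediateField.equivOfEq hmap)).toLinearEquiv.finrank_eq
  rwa [h2] at h


/-! ### G8: the absolute Galois group and a finite normal subextension -/

section AbsoluteGalois

variable {F : Type} [Field F] {N₀ : IntermediateField F (AlgebraicClosure F)} [Normal F N₀]
  {q : Field.absoluteGaloisGroup F →* (N₀ ≃ₐ[F] N₀)} (hq : q = AlgEquiv.restrictNormalHom N₀)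
include hq

/-- For the restriction `q : Γ_F → Gal(N₀/F)` (typed on `Field.absoluteGaloisGroup F`):
`ker q = Γ_{N₀}`. [folklore] -/
theorem ker_eq_fixingSubgroup_of_eq_restrictNormalHom : q.ker = N₀.fixingSubgroup := by
  subst hq
  exact IntermediateField.restrictNormalHom_ker N₀

/-- `Γ_F → Gal(N₀/F)` exhibits `Gal(N₀/F)` as a finite Galois group over `F`
(surjective, open kernel) for `N₀/F` finite normal. [folklore] -/
theorem isArtinQuotient_of_eq_restrictNormalHom [FiniteDimensional F N₀] : IsArtinQuotient q where
  surjective := by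
    subst hq
    exact AlgEquiv.restrictNormalHom_surjective (F := F) (K₁ := N₀) (E := AlgebraicClosure F)
  isOpen_ker := by
    rw [ker_eq_fixingSubgroup_of_eq_restrictNormalHom hq]
    exact IntermediateField.fixingSubgroup_isOpen N₀

/-- For `E ≤ N₀`, the preimage of the image of `Γ_E` in `Gal(N₀/F)` is `Γ_E`. [folklore] -/
theorem comap_map_fixingSubgroup_of_eq_restrictNormalHom {E : IntermediateField F (AlgebraicClosure F)}
    (hE : E ≤ N₀) : ((E.fixingSubgroup).map q).comap q = E.fixingSubgroup := by
  rw [Subgroup.comap_map_eq, ker_eq_fixingSubgroup_of_eq_restrictNormalHom hq, sup_eq_left]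
  exact IntermediateField.fixingSubgroup_le hE

variable [CharZero F]

/-- The fixed field cut out by the image of `Γ_E` (`E ≤ N₀`) is `E`. [folklore] -/
theorem quotientFixedField_map_fixingSubgroup {E : IntermediateField F (AlgebraicClosure F)}
    (hE : E ≤ N₀) : quotientFixedField q ((E.fixingSubgroup).map q) = E :=
  (congrArg IntermediateField.fixedField (comap_map_fixingSubgroup_of_eq_restrictNormalHom hq hE)).trans
    (InfiniteGalois.fixedField_fixingSubgroup E)

/-- The fixed field cut out by the trivial subgroup is `N₀`. [folklore] -/
theorem quotientFixedField_bot_of_eq_restrictNormalHom : quotientFixedField q ⊥ = N₀ :=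
  (congrArg IntermediateField.fixedField
    ((MonoidHom.comap_bot q).trans (ker_eq_fixingSubgroup_of_eq_restrictNormalHom hq))).trans
    (InfiniteGalois.fixedField_fixingSubgroup N₀)

omit [Normal F N₀] hq in
/-- The fixed field cut out by the whole group is `F`. [folklore] -/
theorem quotientFixedField_top_eq_bot : quotientFixedField q ⊤ = ⊥ :=
  (congrArg IntermediateField.fixedField (Subgroup.comap_top q)).trans
    InfiniteGalois.fixedField_bot

end AbsoluteGalois

/-! ### G9: analytic glue — iso-invariance of orders, Stark's Lemma 3 as an order bound -/

/-- Ring-isomorphic number fields have the same continued Dedekind zeta function off `s = 1`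
(ring isomorphisms of `ℚ`-algebras are `ℚ`-linear). [folklore] -/
theorem dedekindZetaCont_eq_of_ringEquiv {K K' : Type*} [Field K] [NumberField K] [Field K']
    [NumberField K'] (e : K ≃+* K') {s : ℂ} (hs : s ≠ 1) :
    dedekindZetaCont K s = dedekindZetaCont K' s :=
  dedekindZetaCont_eq_of_algEquiv (AlgEquiv.ofRingEquiv (f := e) (RingHom.map_rat_algebraMap e.toRingHom))
    hs

/-- Ring-isomorphic number fields: `ord_{s} ζ_K = ord_{s} ζ_{K'}` for `s ≠ 1`. [folklore] -/
theorem meromorphicOrderAt_dedekindZetaCont_eq_of_ringEquiv {K K' : Type*} [Field K]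
    [NumberField K] [Field K'] [NumberField K'] (e : K ≃+* K') {s : ℂ} (hs : s ≠ 1) :
    meromorphicOrderAt (dedekindZetaCont K) s = meromorphicOrderAt (dedekindZetaCont K') s := by
  apply meromorphicOrderAt_congr
  have h : ∀ᶠ z in nhds s, dedekindZetaCont K z = dedekindZetaCont K' z := by
    filter_upwards [isOpen_compl_singleton.mem_nhds hs] with z hz
    exact dedekindZetaCont_eq_of_ringEquiv e hz
  exact h.filter_mono nhdsWithin_le_nhds

/-- **Stark's Lemma 3 as an order bound**: for `N ≠ ℚ` and `s ≠ 1` in Stark's box for `|d_N|`,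
`ord_{s} ζ_N ≤ 1`. [cite: MurtyMurty1997, Ch. 2 Prop. 6.1] [cite: Stark1974, Lemma 3] -/
theorem meromorphicOrderAt_dedekindZetaCont_le_one (N : Type) [Field N] [NumberField N]
    (hN : 1 < Module.finrank ℚ N) {s : ℂ} (hs : s ≠ 1)
    (hbox : s ∈ starkBox ((discr N).natAbs : ℝ)) :
    meromorphicOrderAt (dedekindZetaCont N) s ≤ 1 := by
  have han : AnalyticAt ℂ (dedekindZetaCont N) s := analyticAt_dedekindZetaCont hs
  rw [han.meromorphicOrderAt_eq]
  by_cases h0 : dedekindZetaCont N s = 0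
  · have hz : dedekindZeta₁ N s = 0 := (dedekindZeta₁_eq_zero_iff hs).mpr h0
    have hord := ((Stark1974_atMostOneZero_holds N hN).2 s hz hbox).2
    rw [analyticOrderAt_dedekindZeta₁_eq_dedekindZetaCont hs] at hord
    rw [hord]
    exact le_rfl
  · rw [han.analyticOrderAt_eq_zero.mpr h0]
    exact zero_le_one

/-- The interval of Theorem 3 lies in Stark's box for the Galois closure: if `2 ≤ d_N ≤ d_K^m`,
`m ≤ k`, then `1 − 1/(4 k log d_K) ≤ σ` implies `1 − 1/(4 log d_N) ≤ σ`. [cite: Stark1974, §3] -/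
theorem one_sub_inv_log_le {dK dN m k : ℕ} {σ : ℝ} (hdK : 1 ≤ dK) (hdN : 2 ≤ dN)
    (hle : dN ≤ dK ^ m) (hm : m ≤ k)
    (hσ : 1 - 1 / (4 * (k : ℝ) * Real.log dK) ≤ σ) : 1 - 1 / (4 * Real.log dN) ≤ σ := by
  have hdK' : (1 : ℝ) ≤ dK := by exact_mod_cast hdK
  have hdN' : (1 : ℝ) < dN := by exact_mod_cast hdN
  have hlogK : 0 ≤ Real.log dK := Real.log_nonneg hdK'
  have hlogN : 0 < Real.log dN := Real.log_pos hdN'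
  have h1 : Real.log dN ≤ k * Real.log dK := by
    calc Real.log dN ≤ Real.log ((dK : ℝ) ^ m) :=
          Real.log_le_log (by positivity) (by exact_mod_cast hle)
      _ = m * Real.log dK := Real.log_pow (dK : ℝ) m
      _ ≤ k * Real.log dK := mul_le_mul_of_nonneg_right (by exact_mod_cast hm) hlogK
  have h2 : 1 / (4 * (k : ℝ) * Real.log dK) ≤ 1 / (4 * Real.log dN) :=
    one_div_le_one_div_of_le (by positivity) (by nlinarith)
  linarith

/-- `σ > 0` on the interval of Theorem 3 when `n ≥ 2`, `|d_K| ≥ 3`. [folklore] -/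
theorem pos_of_one_sub_inv_log_le {dK k : ℕ} {σ : ℝ} (hdK : 3 ≤ dK) (hk : 2 ≤ k)
    (hσ : 1 - 1 / (4 * (k : ℝ) * Real.log dK) ≤ σ) : 0 < σ := by
  have hdK' : (3 : ℝ) ≤ dK := by exact_mod_cast hdK
  have hk' : (2 : ℝ) ≤ k := by exact_mod_cast hk
  have hlog : 1 < Real.log dK := by
    rw [← Real.log_exp 1]
    refine Real.log_lt_log (Real.exp_pos 1) (lt_of_lt_of_le ?_ hdK')
    have := Real.exp_one_lt_d9
    linarith
  have h8 : (8 : ℝ) ≤ 4 * (k : ℝ) * Real.log dK := by nlinarith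
  have h2 : 1 / (4 * (k : ℝ) * Real.log dK) ≤ 1 / 8 :=
    one_div_le_one_div_of_le (by norm_num) h8
  linarith

/-- Transport of `finrank ℚ` between the (propositionally equal) `ℚ`-actions. [folklore] -/
theorem finrank_rat_eq_finrank_rat {V : Type*} [AddCommGroup V] (i j : Module ℚ V) :
    @Module.finrank ℚ V _ _ i = @Module.finrank ℚ V _ _ j := by
  rw [Subsingleton.elim i j]

end Literature.NumberTheory.LFunctions.NumberField

end
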